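import Literature.Analysis.FluidPDE.ElgindiStripCalculus
import Mathlib.MeasureTheory.Integral.Prod
import Mathlib.MeasureTheory.Integral.DominatedConvergence
import HarnessLib

/-!
# Slice bounds on the strip: `sup_R ∫ G(R,θ)² dθ` from `∬ G²` and `∬ (∂_R G)²`
([Elgindi2021] §7.1: boundary behaviour of the weak solution, slice by slice)

Topic `Literature/Analysis/FluidPDE`. Proof file (everything proved, no definitions, no named
facts) on the proof path of the named fact
`Literature.Analysis.FluidPDE.Elgindi.ElgindiGhoulMasmoudi2021_stabilityCore`
(`ElgindiStabilityDecomposition.lean`). T. M. Elgindi, Ann. of Math. 194 (2021) =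
arXiv:1904.04795, §7.1 Proposition 7.1 (p. 19 of the held text).

Elementary one-dimensional Sobolev bounds on an interval (`sq_le_of_hasDerivAt`) and their
consequence for functions `G` that are `C¹` on the open strip: for `R ∈ [a,b] ⊂ (0,∞)` and
`θ ∈ (0,π/2)`, `G(R,θ)² ≤ m(θ)` with `∫ m ≤ (2/(b−a))∬_{(a,b)×(0,π/2)} G² + 2(b−a)∬ (∂_RG)²`
(`exists_slice_dominator`); hence every slice `G(R,·)` is square integrable with a bound uniform in
`R ∈ [a,b]` (`integral_slice_sq_le`), and slice pairings `R ↦ ∫ G(R,θ)φ(θ)dθ` are continuous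
(`continuousOn_slice_integral`). These turn the `L²(strip)` information carried by the energy space
into statements about every slice of the (interior-smooth) weak solution.
-/

noncomputable section

open MeasureTheory Set Real Filter Function
open _root_.Topology

namespace Literature.Analysis.FluidPDE

namespace Elgindi

/-! ### One-dimensional bounds on an interval -/

/-- Mean value for integrals: a point where `v² ≤` its average. [folklore] -/
theorem exists_sq_mul_le_integral_on {v : ℝ → ℝ} {p q : ℝ} (hv : ContinuousOn v (Icc p q)) (hpq : p < q) :
    ∃ ξ ∈ Icc p q, v ξ ^ 2 * (q - p) ≤ ∫ x in p..q, v x ^ 2 := by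
  by_contra h
  simp only [not_exists, not_and, not_le] at h
  have hcont : ContinuousOn (fun x => v x ^ 2) (Icc p q) := hv.pow 2
  obtain ⟨ξ, hξ, hmin⟩ := isCompact_Icc.exists_isMinOn (nonempty_Icc.2 hpq.le) hcont
  have hle : ∫ x in p..q, v ξ ^ 2 ≤ ∫ x in p..q, v x ^ 2 :=
    intervalIntegral.integral_mono_on hpq.le (by simp) (hcont.intervalIntegrable_of_Icc hpq.le)
      fun x hx => hmin hx
  rw [intervalIntegral.integral_const, smul_eq_mul] at hle
  have := h ξ hξ
  nlinarith

/-- Cauchy–Schwarz on an interval for a function continuous on it. [folklore] -/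
theorem sq_intervalIntegral_le_on {f : ℝ → ℝ} {a b : ℝ} (hf : ContinuousOn f (Icc a b)) (hab : a ≤ b) :
    (∫ x in a..b, f x) ^ 2 ≤ (b - a) * ∫ x in a..b, f x ^ 2 := by
  rcases hab.lt_or_eq with hlt | heq
  · set m : ℝ := (∫ x in a..b, f x) / (b - a) with hm
    have i1 : IntervalIntegrable (fun x => f x ^ 2) volume a b := (hf.pow 2).intervalIntegrable_of_Icc hab
    have i0 : IntervalIntegrable f volume a b := hf.intervalIntegrable_of_Icc hab
    have i2 : IntervalIntegrable (fun x => 2 * m * f x) volume a b := i0.const_mul _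
    have h0 : 0 ≤ ∫ x in a..b, (f x - m) ^ 2 :=
      intervalIntegral.integral_nonneg hlt.le fun x _ => sq_nonneg _
    have e : ∫ x in a..b, (f x - m) ^ 2 = (∫ x in a..b, f x ^ 2) - 2 * m * (∫ x in a..b, f x) + (b - a) * m ^ 2 := by
      have e1 : (fun x => (f x - m) ^ 2) = fun x => f x ^ 2 - 2 * m * f x + m ^ 2 := by funext x; ring
      rw [e1, intervalIntegral.integral_add (i1.sub i2) (by simp), intervalIntegral.integral_sub i1 i2,
        intervalIntegral.integral_const_mul, intervalIntegral.integral_const, smul_eq_mul]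
    rw [e] at h0
    have hm' : m * (b - a) = ∫ x in a..b, f x := by rw [hm]; field_simp
    nlinarith [hm']
  · subst heq; simp

/-- **One-dimensional Sobolev bound**: if `v` has derivative `v′` on `[p,q]` with `v′` continuous
there, then `v(x)² ≤ (2/(q−p))∫_p^q v² + 2(q−p)∫_p^q v′²` for all `x ∈ [p,q]`. [folklore] -/
theorem sq_le_of_hasDerivAt {v v' : ℝ → ℝ} {p q : ℝ} (hpq : p < q) (hv : ∀ x ∈ Icc p q, HasDerivAt v (v' x) x)
    (hv' : ContinuousOn v' (Icc p q)) {x : ℝ} (hx : x ∈ Icc p q) :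
    v x ^ 2 ≤ 2 / (q - p) * (∫ y in p..q, v y ^ 2) + 2 * (q - p) * ∫ y in p..q, v' y ^ 2 := by
  have hvc : ContinuousOn v (Icc p q) := fun y hy => (hv y hy).continuousAt.continuousWithinAt
  obtain ⟨ξ, hξ, hξle⟩ := exists_sq_mul_le_integral_on hvc hpq
  have hL : 0 < q - p := by linarith
  -- `v x = v ξ + ∫_ξ^x v'`
  have hsub : ∀ {s t : ℝ}, s ∈ Icc p q → t ∈ Icc p q → s ≤ t → v t - v s = ∫ y in s..t, v' y := by
    intro s t hs ht hst
    have := intervalIntegral.integral_eq_sub_of_hasDerivAt (f := v) (f' := v') (a := s) (b := t)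
      (fun y hy => hv y ⟨hs.1.trans (by rw [uIcc_of_le hst] at hy; exact hy.1), (by rw [uIcc_of_le hst] at hy; exact hy.2.trans ht.2)⟩)
      ((hv'.mono (Icc_subset_Icc hs.1 ht.2)).intervalIntegrable_of_Icc hst)
    exact this.symm
  have hCS : ∀ {s t : ℝ}, s ∈ Icc p q → t ∈ Icc p q → s ≤ t → (∫ y in s..t, v' y) ^ 2 ≤ (q - p) * ∫ y in p..q, v' y ^ 2 := by
    intro s t hs ht hst
    have h1 := sq_intervalIntegral_le_on (hv'.mono (Icc_subset_Icc hs.1 ht.2)) hst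
    have h2 : ∫ y in s..t, v' y ^ 2 ≤ ∫ y in p..q, v' y ^ 2 :=
      intervalIntegral.integral_mono_interval hs.1 hst ht.2 (Filter.Eventually.of_forall fun y => sq_nonneg _)
        ((hv'.pow 2).intervalIntegrable_of_Icc hpq.le)
    have h3 : 0 ≤ ∫ y in p..q, v' y ^ 2 := intervalIntegral.integral_nonneg hpq.le fun y _ => sq_nonneg _
    calc (∫ y in s..t, v' y) ^ 2 ≤ (t - s) * ∫ y in s..t, v' y ^ 2 := h1
      _ ≤ (q - p) * ∫ y in p..q, v' y ^ 2 := by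
          apply mul_le_mul (by linarith [hs.1, ht.2]) h2 (intervalIntegral.integral_nonneg hst fun y _ => sq_nonneg _) hL.le
  have hI0 : 0 ≤ ∫ y in p..q, v y ^ 2 := intervalIntegral.integral_nonneg hpq.le fun y _ => sq_nonneg _
  have hξ2 : v ξ ^ 2 ≤ (∫ y in p..q, v y ^ 2) / (q - p) := by rw [le_div_iff₀ hL]; exact hξle
  rcases le_total ξ x with h | h
  · have e := hsub hξ hx h
    have c := hCS hξ hx h
    have : v x = v ξ + ∫ y in ξ..x, v' y := by linarith
    calc v x ^ 2 = (v ξ + ∫ y in ξ..x, v' y) ^ 2 := by rw [this]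
      _ ≤ 2 * v ξ ^ 2 + 2 * (∫ y in ξ..x, v' y) ^ 2 := by nlinarith [sq_nonneg (v ξ - ∫ y in ξ..x, v' y)]
      _ ≤ 2 * ((∫ y in p..q, v y ^ 2) / (q - p)) + 2 * ((q - p) * ∫ y in p..q, v' y ^ 2) := by gcongr
      _ = _ := by ring
  · have e := hsub hx hξ h
    have c := hCS hx hξ h
    have : v x = v ξ - ∫ y in x..ξ, v' y := by linarith
    calc v x ^ 2 = (v ξ - ∫ y in x..ξ, v' y) ^ 2 := by rw [this]
      _ ≤ 2 * v ξ ^ 2 + 2 * (∫ y in x..ξ, v' y) ^ 2 := by nlinarith [sq_nonneg (v ξ + ∫ y in x..ξ, v' y)]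
      _ ≤ 2 * ((∫ y in p..q, v y ^ 2) / (q - p)) + 2 * ((q - p) * ∫ y in p..q, v' y ^ 2) := by gcongr
      _ = _ := by ring

/-! ### Slices of functions that are `C¹` on the open strip -/

section slices

variable {G : ℝ → ℝ → ℝ} {a b : ℝ}

/-- Radial slices inside the strip have the expected derivative. [folklore] -/
theorem hasDerivAt_radial_slice (hG : ContDiffOn ℝ 1 (uncurry G) strip) {θ : ℝ} (hθ : θ ∈ Ioo 0 (π / 2)) {R : ℝ} (hR : 0 < R) :
    HasDerivAt (fun R' => G R' θ) (dz G R θ) R := by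
  have hp : (R, θ) ∈ strip := ⟨hR, hθ⟩
  have hd : DifferentiableAt ℝ (uncurry G) (R, θ) := (hG.differentiableOn (by norm_num) _ hp).differentiableAt (isOpen_strip.mem_nhds hp)
  have hc : HasDerivAt (fun R' : ℝ => (R', θ)) ((1 : ℝ), (0 : ℝ)) R := (hasDerivAt_id R).prodMk (hasDerivAt_const R θ)
  have h := hd.hasFDerivAt.comp_hasDerivAt R hc
  have e : (fun R' => G R' θ) = uncurry G ∘ fun R' => (R', θ) := rfl
  show HasDerivAt (fun R' => G R' θ) (deriv (fun R' => G R' θ) R) R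
  rw [e, h.deriv]; exact h

/-- The pointwise bound `G(R,θ)² ≤ m(θ)` for `R ∈ [a,b]`, with the explicit dominator
`m(θ) = (2/(b−a))∫_a^b G(·,θ)² + 2(b−a)∫_a^b (∂_RG)(·,θ)²`. [folklore] -/
theorem sq_slice_le (hG : ContDiffOn ℝ 1 (uncurry G) strip) (ha : 0 < a) (hab : a < b) {θ : ℝ} (hθ : θ ∈ Ioo 0 (π / 2))
    {R : ℝ} (hR : R ∈ Icc a b) :
    G R θ ^ 2 ≤ 2 / (b - a) * (∫ y in a..b, G y θ ^ 2) + 2 * (b - a) * ∫ y in a..b, dz G y θ ^ 2 := by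
  refine sq_le_of_hasDerivAt hab (fun x hx => hasDerivAt_radial_slice hG hθ (ha.trans_le hx.1)) ?_ hR
  have hc : ContinuousOn (uncurry (dz G)) strip := (contDiffOn_dz (n := 0) (by simpa using hG)).continuousOn
  have hsl : ContinuousOn (fun y : ℝ => (y, θ)) (Icc a b) := (continuous_id.prodMk continuous_const).continuousOn
  exact hc.comp hsl fun w hw => ⟨ha.trans_le hw.1, hθ⟩

/-- Continuity of radial slices on `[a,b]`. [folklore] -/
theorem continuousOn_radial_slice (hG : ContDiffOn ℝ 1 (uncurry G) strip) (ha : 0 < a) {θ : ℝ} (hθ : θ ∈ Ioo 0 (π / 2)) :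
    ContinuousOn (fun y => G y θ) (Icc a b) :=
  fun _ hy => (hasDerivAt_radial_slice hG hθ (ha.trans_le hy.1)).continuousAt.continuousWithinAt

/-- Continuity of the radial derivative along radial slices on `[a,b]`. [folklore] -/
theorem continuousOn_dz_radial_slice (hG : ContDiffOn ℝ 1 (uncurry G) strip) (ha : 0 < a) {θ : ℝ} (hθ : θ ∈ Ioo 0 (π / 2)) :
    ContinuousOn (fun y => dz G y θ) (Icc a b) := by
  have hc : ContinuousOn (uncurry (dz G)) strip := (contDiffOn_dz (n := 0) (by simpa using hG)).continuousOn
  have hsl : ContinuousOn (fun y : ℝ => (y, θ)) (Icc a b) := (continuous_id.prodMk continuous_const).continuousOn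
  exact hc.comp hsl fun w hw => ⟨ha.trans_le hw.1, hθ⟩

/-- **The slice dominator is integrable**: with `Q = (a,b) × (0,π/2)`,
`∫_0^{π/2} [(2/(b−a))∫_a^b G(·,θ)² + 2(b−a)∫_a^b (∂_RG)(·,θ)²] dθ = (2/(b−a))∬_Q G² + 2(b−a)∬_Q (∂_RG)²`
whenever `G, ∂_RG ∈ L²(Q)`. [folklore] -/
theorem integral_dominator_eq (hab : a < b) (hG2 : IntegrableOn (fun p : ℝ × ℝ => G p.1 p.2 ^ 2) (Ioo a b ×ˢ Ioo 0 (π / 2)))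
    (hdG2 : IntegrableOn (fun p : ℝ × ℝ => dz G p.1 p.2 ^ 2) (Ioo a b ×ˢ Ioo 0 (π / 2))) :
    IntegrableOn (fun θ => 2 / (b - a) * (∫ y in a..b, G y θ ^ 2) + 2 * (b - a) * ∫ y in a..b, dz G y θ ^ 2) (Ioo 0 (π / 2)) ∧
    ∫ θ in Ioo 0 (π / 2), (2 / (b - a) * (∫ y in a..b, G y θ ^ 2) + 2 * (b - a) * ∫ y in a..b, dz G y θ ^ 2) =
      2 / (b - a) * (∫ p in Ioo a b ×ˢ Ioo 0 (π / 2), G p.1 p.2 ^ 2) + 2 * (b - a) * ∫ p in Ioo a b ×ˢ Ioo 0 (π / 2), dz G p.1 p.2 ^ 2 := by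
  have hprod : (volume.restrict (Ioo a b ×ˢ Ioo 0 (π / 2)) : Measure (ℝ × ℝ)) =
      (volume.restrict (Ioo a b)).prod (volume.restrict (Ioo 0 (π / 2))) := by
    rw [Measure.volume_eq_prod, Measure.prod_restrict]
  -- iterated integrals in the order `θ` outer, `R` inner
  have key : ∀ {g : ℝ → ℝ → ℝ}, IntegrableOn (fun p : ℝ × ℝ => g p.1 p.2 ^ 2) (Ioo a b ×ˢ Ioo 0 (π / 2)) →
      Integrable (fun θ => ∫ y in a..b, g y θ ^ 2) (volume.restrict (Ioo 0 (π / 2))) ∧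
      ∫ θ in Ioo 0 (π / 2), (∫ y in a..b, g y θ ^ 2) = ∫ p in Ioo a b ×ˢ Ioo 0 (π / 2), g p.1 p.2 ^ 2 := by
    intro g hg
    rw [IntegrableOn, hprod] at hg
    have h1 := hg.integral_prod_right
    have h2 := integral_prod_symm _ hg
    have e : ∀ θ, ∫ y in a..b, g y θ ^ 2 = ∫ y, (fun p : ℝ × ℝ => g p.1 p.2 ^ 2) (y, θ) ∂(volume.restrict (Ioo a b)) := fun θ => by
      rw [intervalIntegral.integral_of_le hab.le, integral_Ioc_eq_integral_Ioo]
    refine ⟨h1.congr (ae_of_all _ fun θ => (e θ).symm), ?_⟩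
    rw [show (∫ p in Ioo a b ×ˢ Ioo 0 (π / 2), g p.1 p.2 ^ 2) = ∫ p, g p.1 p.2 ^ 2 ∂((volume.restrict (Ioo a b)).prod (volume.restrict (Ioo 0 (π / 2)))) by
      rw [← hprod]]
    rw [h2]
    exact integral_congr_ae (ae_of_all _ fun θ => e θ)
  obtain ⟨i1, e1⟩ := key hG2
  obtain ⟨i2, e2⟩ := key hdG2
  refine ⟨((i1.const_mul _).add (i2.const_mul _)), ?_⟩
  rw [integral_add (i1.const_mul _) (i2.const_mul _), MeasureTheory.integral_const_mul, MeasureTheory.integral_const_mul, e1, e2]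

/-- **Uniform slice bound**: for `R ∈ [a,b]`, the slice `G(R,·)` is square integrable on `(0,π/2)`
and `∫_0^{π/2} G(R,θ)² dθ ≤ (2/(b−a))∬_Q G² + 2(b−a)∬_Q (∂_RG)²`. [folklore] -/
theorem integral_slice_sq_le (hG : ContDiffOn ℝ 1 (uncurry G) strip) (ha : 0 < a) (hab : a < b)
    (hG2 : IntegrableOn (fun p : ℝ × ℝ => G p.1 p.2 ^ 2) (Ioo a b ×ˢ Ioo 0 (π / 2)))
    (hdG2 : IntegrableOn (fun p : ℝ × ℝ => dz G p.1 p.2 ^ 2) (Ioo a b ×ˢ Ioo 0 (π / 2))) {R : ℝ} (hR : R ∈ Icc a b) :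
    IntegrableOn (fun θ => G R θ ^ 2) (Ioo 0 (π / 2)) ∧
    ∫ θ in Ioo 0 (π / 2), G R θ ^ 2 ≤
      2 / (b - a) * (∫ p in Ioo a b ×ˢ Ioo 0 (π / 2), G p.1 p.2 ^ 2) + 2 * (b - a) * ∫ p in Ioo a b ×ˢ Ioo 0 (π / 2), dz G p.1 p.2 ^ 2 := by
  obtain ⟨im, em⟩ := integral_dominator_eq hab hG2 hdG2
  have hRpos : 0 < R := ha.trans_le hR.1
  -- measurability of the slice: continuous on `(0, π/2)`
  have hcs : ContinuousOn (fun θ => G R θ) (Ioo 0 (π / 2)) := by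
    have hc : ContinuousOn (uncurry G) strip := hG.continuousOn
    exact hc.comp (continuous_const.prodMk continuous_id).continuousOn fun θ hθ => ⟨hRpos, hθ⟩
  have hmeas : AEStronglyMeasurable (fun θ => G R θ ^ 2) (volume.restrict (Ioo 0 (π / 2))) :=
    ((hcs.pow 2).aestronglyMeasurable measurableSet_Ioo)
  have hle : ∀ θ ∈ Ioo 0 (π / 2), G R θ ^ 2 ≤ 2 / (b - a) * (∫ y in a..b, G y θ ^ 2) + 2 * (b - a) * ∫ y in a..b, dz G y θ ^ 2 :=
    fun θ hθ => sq_slice_le hG ha hab hθ hR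
  have hI : IntegrableOn (fun θ => G R θ ^ 2) (Ioo 0 (π / 2)) := by
    refine Integrable.mono' im hmeas ?_
    rw [ae_restrict_iff' measurableSet_Ioo]
    exact ae_of_all _ fun θ hθ => by rw [Real.norm_eq_abs, abs_of_nonneg (sq_nonneg _)]; exact hle θ hθ
  refine ⟨hI, ?_⟩
  rw [← em]
  exact setIntegral_mono_on hI im measurableSet_Ioo hle

/-- **Continuity of slice pairings**: if `G ∈ C¹(strip)` with `G, ∂_RG ∈ L²_loc` in `R` (on every
`(a,b) × (0,π/2)`, `0 < a < b`), then `R ↦ ∫_0^{π/2} G(R,θ)φ(θ) dθ` is continuous on `(0,∞)` for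
every bounded measurable `φ` (dominated convergence with the slice dominator). [folklore] -/
theorem continuousOn_slice_integral (hG : ContDiffOn ℝ 1 (uncurry G) strip)
    (hloc : ∀ a b : ℝ, 0 < a → a < b →
      IntegrableOn (fun p : ℝ × ℝ => G p.1 p.2 ^ 2) (Ioo a b ×ˢ Ioo 0 (π / 2)) ∧
      IntegrableOn (fun p : ℝ × ℝ => dz G p.1 p.2 ^ 2) (Ioo a b ×ˢ Ioo 0 (π / 2)))
    {φ : ℝ → ℝ} (hφm : Measurable φ) {C : ℝ} (hφ : ∀ θ, |φ θ| ≤ C) :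
    ContinuousOn (fun R => ∫ θ in Ioo 0 (π / 2), G R θ * φ θ) (Ioi 0) := by
  intro R₀ hR₀
  have hR₀' : 0 < R₀ := hR₀
  refine ContinuousAt.continuousWithinAt ?_
  set a := R₀ / 2
  set b := 2 * R₀
  have ha : 0 < a := by positivity
  have hab : a < b := by show R₀ / 2 < 2 * R₀; linarith
  obtain ⟨hG2, hdG2⟩ := hloc a b ha hab
  obtain ⟨im, -⟩ := integral_dominator_eq hab hG2 hdG2
  set m : ℝ → ℝ := fun θ => 2 / (b - a) * (∫ y in a..b, G y θ ^ 2) + 2 * (b - a) * ∫ y in a..b, dz G y θ ^ 2 with hm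
  have hnhds : Icc a b ∈ 𝓝 R₀ := Icc_mem_nhds (by show R₀ / 2 < R₀; linarith) (by show R₀ < 2 * R₀; linarith)
  have hC0 : 0 ≤ C := (abs_nonneg _).trans (hφ 0)
  refine MeasureTheory.continuousAt_of_dominated (bound := fun θ => C * ((1 + m θ) / 2)) ?_ ?_ ?_ ?_
  · filter_upwards [hnhds] with R hR
    have hRpos : 0 < R := ha.trans_le hR.1
    have hcs : ContinuousOn (fun θ => G R θ) (Ioo 0 (π / 2)) :=
      hG.continuousOn.comp (continuous_const.prodMk continuous_id).continuousOn fun θ hθ => ⟨hRpos, hθ⟩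
    exact (hcs.aestronglyMeasurable measurableSet_Ioo).mul hφm.aestronglyMeasurable
  · filter_upwards [hnhds] with R hR
    rw [ae_restrict_iff' measurableSet_Ioo]
    refine ae_of_all _ fun θ hθ => ?_
    have h1 := sq_slice_le hG ha hab hθ hR
    rw [Real.norm_eq_abs, abs_mul]
    have h2 : |G R θ| ≤ (1 + m θ) / 2 := by
      have : |G R θ| ≤ (1 + G R θ ^ 2) / 2 := by nlinarith [sq_nonneg (|G R θ| - 1), sq_abs (G R θ), abs_nonneg (G R θ)]
      have hm' : G R θ ^ 2 ≤ m θ := h1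
      linarith
    calc |G R θ| * |φ θ| ≤ (1 + m θ) / 2 * C := mul_le_mul h2 (hφ θ) (abs_nonneg _) (by
          have : 0 ≤ m θ := (sq_nonneg _).trans h1; linarith)
      _ = C * ((1 + m θ) / 2) := by ring
  · have : IntegrableOn (fun θ => (1 + m θ) / 2) (Ioo 0 (π / 2)) := by
      have h1 : IntegrableOn (fun _ => (1:ℝ)) (Ioo 0 (π / 2)) volume := integrableOn_const (by simp) 
      exact ((h1.add im).div_const 2)
    exact this.const_mul C
  · rw [ae_restrict_iff' measurableSet_Ioo]
    refine ae_of_all _ fun θ hθ => ?_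
    exact ((hasDerivAt_radial_slice hG hθ hR₀').continuousAt.mul continuousAt_const)

end slices

end Elgindi

end Literature.Analysis.FluidPDE
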